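/-
Origin: expansion seat `planner-pub-hodgecm-prl2-g5-0`, handover #6 2026-08-18T09:14:41Z doc-only (`HOME/pub-hodgecm-prl2-g5/lean/Prl2g5/ComponentTower.lean`, md5 a36e032d, 362 lines);
landed by the gen-7 packager in gate run 27 REPLACES the earlier landed copy of `HodgeCM/StubTree/ComponentTower.lean` (verbatim).
-/
/-
Copyright: pub-hodgecm expansion lineage prl2 (REDUCE `RealisationExistsPerL` / `Face`), generation 5.
Authors: planner-pub-hodgecm-prl2-g5-0.

# (I5) ∧ (I6) DERIVED from a COMPONENT-AWARE tower dictionary — and the RETRACTION of three gen-4 tower seams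
# (REDUCTION-v5 §R.11; GAPS prl2g5-M1)

ADDITIVE to `HodgeCM.StubTree.{PairingReduction, PairingFromMatsushima, TranslateFromTower, ExpandFromTower}` (runs 23–25):
nothing landed changes; the packages `MatsushimaTowerFree*` / `MatsushimaBlockFree*` of the last two files are SUPERSEDED
by `MatsushimaCompFree*` below, for the following reason.

## M1 (this generation's finding, model level): the identity component SPLITS in the tower

`P_Γ = Γ\𝔹²` is the IDENTITY COMPONENT of `Sh^K = G_U(L⁺)\[𝔹² × G_U(𝔸_{L⁺,f})]/K` for any compact open `K` with
`K ∩ G_U(L⁺) = Γ` (Getz–Hahn (15.1)–(15.2), verbatim "this is a finite union of locally symmetric spaces …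
`⊔_{i∈I} Γᵢ\X ≅ Sh_K`, `Γᵢ = gᵢKgᵢ⁻¹ ∩ G(ℚ)`" [held p0312 L36–p0313 L4]), and `π₀(Sh^K) = C_K := T(L⁺)\T(𝔸_{L⁺,f})/det K`
(`T = U(1)_{L/L⁺} = det G_U`; STRONG APPROXIMATION for the simply connected `SU(V,h)`, non-compact at `ι₁`: Margulis
II.6.8 Theorem, verbatim "Suppose the group `G_ℰ` is not compact … Then the subgroup `G(K)G_ℰ` is dense in `G(𝔸_K)`"
[held p0135 L9]; the (U)-reading step (S0) of `PairingFromMatsushima`).  For a deeper level `K″ ⊂ K` the identity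
component of `Sh^K` is covered by `|ker(C_{K″} → C_K)|` components of `Sh^{K″}`, of which `P_{Γ″}` is only ONE; the number
is `> 1` as soon as `det K″ ⊊ det K · (T(L⁺) ∩ det K)`, which happens cofinally (the `det K` shrink to `1`).  Two
consequences for the dictionary "form on `P_Γ` ↦ its extension by zero `vec_Γ c ∈ 𝓗 ⊂ L²(G_U(L⁺)\G_U(𝔸))`":
 (a) pull-back along the covering `F : P_{Γ″} → P_Γ` is `vec_{Γ″} ∘ F^* = e₁^{K″} ∘ vec_Γ` with `e₁^{K″} = 𝟙_{identity
     component of level K″} = |C_{K″}|⁻¹ Σ_{χ ∈ Ĉ_{K″}} U_χ` (`U_χ` = multiplication by `χ∘det`, `Ĉ_{K″}` = the characters of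
     `T(L⁺)\T(𝔸_f)` trivial on `det K″`) — NOT `vec_Γ` itself;
 (b) the automorphic constituents `π′ = π ⊗ χ∘det` (`χ ∈ X_f` = the finite-order characters of `T(L⁺)\T(𝔸_{L⁺,f})`) that
     carry a block-`[π]` form of level `K` form a union of `Ĉ_K`-orbits which GROWS with the level and exhausts the
     INFINITE orbit `X_f·π`; a block-`[π]` form of level `K` is in general a sum over SEVERAL `Ĉ_K`-orbits.
Hence three seams of the gen-4 dictionary are NOT satisfied by the intended model: `AdelicTower.realise` (first clause
`vec Γ″ (F^*c) = vec Γ c`), and the finiteness `[Fintype (ι π)]` on which `AdelicTower.decompose` ("ALL components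
nonzero, at EVERY level"), `AdelicTower.mem_closure` and `BlockSeams.vec_proj` rest.  The kernel theorems
`translate_of_tower`, `expand_of_tower`, `COR_CM_of_liu_tower`, `COR_CM_of_liu_block` remain correct Lean theorems, but
their tower hypothesis is, for the intended model, uninstantiable as documented — they are superseded by this file.  (The
docstring derivation of (I5) in `PairingReduction` — "`c = |C|·e₁c₁` with `c₁ ∈ V_π^K`" — has the same gap (b).)

## The corrected dictionary `IsoDatum.CompTower D Hk` — every field TRUE in the intended model

 (D)  `vec`, `vec_inj`, `κ`, `pair_vec` — as in gen 4 (extension by zero; `∫_{P_Γ} c ∪ \bar d = κ_Γ ⟪vec d, vec c⟫`).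
 (D)  `coeff` — MATRIX COEFFICIENTS ARE PERIOD SUMS.  For EVERY `g ∈ G` and levels `Γ₁, Γ₂` there are finitely many
      levels `Γ^j`, tower coverings `F_j : P_{Γ^j} → P_{Γ₁}` (inclusions), `F′_j : P_{Γ^j} → P_{Γ₂}` (translated by RATIONAL
      `δ_j⁻¹`) and constants `a_j` with `⟪R g (vec y), vec x⟫ = Σ_j a_j ∫_{P_{Γ^j}} F_j^*x ∪ \overline{F′_j^*y}` for all
      `(2,0)`-classes `x, y`.  Derivation: the integrand `z ↦ φ_x(z)·\overline{φ_y(zg)}` lives on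
      `ℛ = 𝔖₁(K₁) ∩ 𝔖₁(K₂)g⁻¹` (`𝔖₁` = identity component), right-invariant under `K♭ = K₁ ∩ gK₂g⁻¹`, hence a finite union
      of `K♭`-components `𝔖_i = G_U(L⁺)(G_∞ × u_iK♭)`, `u_i ∈ K₁`, with `𝔖_i ≅ P_{Γ^i}`, `Γ^i = G_U(L⁺) ∩ u_iK♭u_i⁻¹ ⊂ Γ₁`
      (torsion-free congruence); `𝔖_i g ⊂ 𝔖₁(K₂)` forces `u_i g = δ_i k₂` with `δ_i ∈ G_U(L⁺)` RATIONAL (for ANY `g`), and on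
      `𝔖_i`: `φ_x(a, u_ik) = x(a) = (F_i^*x)(a)`, `φ_y((a, u_ik)g) = y(δ_i⁻¹a) = (F′_i^*y)(a)`, `δ_i⁻¹Γ^iδ_i ⊂ Γ₂`; so the
      coefficient is `Σ_i vol(K♭)·c_∞·∫_{Γ^i\G_∞} (F_i^*x)\overline{(F′_i^*y)}` — Getz–Hahn (15.2) and **(15.4)** p. 298 "we
      have a map `T_g : Sh^{K′} → Sh^K` … These are finite étale maps if `K` and `K′` are neat" [held p0314 L21–33].  This ONE
      seam replaces gen 4's `realise ∧ support ∧ supportU ∧ one_mem` (support is built in: `ℛ = ∅` unless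
      `g ∈ K₁·G_U(L⁺)·K₂`).
 (D)  `tr_comp` — tower coverings compose (`z ↦ γz` then `z ↦ γ′z`).
 (U)  `ι, cls, cls_inj` — the block `[π]` (`π : D.A`) as a family of DISTINCT unitary-equivalence classes of `R` (intended:
      the orbit `X_f·π`, INFINITE — no finiteness is posited), and (D, seam iii) `vec_proj`: `vec ∘ proj_π = P_{B_[π]} ∘ vec`,
      `B_[π] = closure ⨆_i isotypic (cls π i)` (`P_{B_[π]}` commutes with every `U_χ`, hence with `e₁^K`, and with `R`).
 (P∘U) `deepen` — DEEP SUPPORT (S0‴, replacing gen 4's (S0′)).  Two nonzero block-`[π]` classes `c` (level `Γ`),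
      `d` (level `Γ′`) have pull-backs `c₁ = F^*c`, `d₂ = F′^*d` along tower coverings such that `vec d₂ = Σ_{i∈s} e_i` with
      `e_i ∈ isotypic (cls π i)` ALL NONZERO over a FINITE set `s` of the block's classes, and `0 ≠ vec c₁ ∈ closure ⨆_{i∈s}
      isotypic (cls π i)`.  Derivation: `supp(vec c), supp(vec d) ⊂ X_f·π` are finite (forms of a fixed level:
      Borel–Wallach VII **Thm 3.2** "… where the sum is finite" [CITED-FACTS MM-2]); take `K″ ⊂ K ∩ K′` with `det K″` inside the
      kernels of the finitely many finite-order characters `ξ` relating the elements of `supp(c) ∪ supp(d)` (each `ξ` is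
      trivial on an open subgroup of `T(𝔸_f)`), `Γ″ = G_U(L⁺) ∩ K″`, `F, F′` the inclusion coverings; by (a),
      `vec c₁ = e₁″vec c` and `vec d₂ = e₁″vec d` are supported in the single `Ĉ_{K″}`-orbit `s := Ĉ_{K″}·supp(d) =
      Ĉ_{K″}·supp(c)`, and EVERY component of `e₁″vec d` along `s` is nonzero: `P_j(e₁″vec d) = (|Ĉ′|/|Ĉ″|) Σ_{χ ∈ Ĉ″/Ĉ′}
      U_χ P_{j·χ⁻¹}(vec d)` (`Ĉ′ = Ĉ_{K′}` fixes `vec d`), whose terms are `R(K′)`-eigenvectors for the pairwise distinct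
      characters `k ↦ χ(det k)` of `K′` (`R(k)U_χ = χ(det k)U_χR(k)`), hence pairwise orthogonal (this step is KERNEL in
      the abstract: `HodgeCM.RepDecomp.sum_ne_zero_of_eigen_pairwise_ne`, file `HodgeCM/Automorphic/TwistSupport.lean`, gen 5), the `χ = 1` term being
      `P_j(vec d) ≠ 0` for `j ∈ supp(d)` (then transport along `Ĉ″` by the `U_χ`, which fix `e₁″vec d`); `c₁ ≠ 0` as `F` is a
      covering of the connected `P_Γ`.
 (P, BY NAME — the hypothesis `CompTower.MultOne`) MULTIPLICITY ONE `RepDecomp.MultiplicityOne R (cls π i)` for every class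
      of every block: Rogawski, *Automorphic representations of unitary groups in three variables* (1990) [Rog90] **§14.6 for the
      inner form `G′ = G_U` (`2 ≤ d`)**: p. 242 exhaustion [p0236 L8] (P), **Prop 14.6.2** + proof p. 243 [p0237 L1–6] (stable packets —
      a READING, typed `HodgeCM.Literature.Rogawski.U3Spectrum.PacketClasses.reading_prop1462_stable_mult_one`, class U),
      **Thm 14.6.4** [p0238 L9] (P, as `m ∈ {0,1}`; parity criterion superseded by [Rog92] Thm 1.2), **Thm 14.6.5** + p. 245
      [p0239 L3–15] (P); Thm 13.3.3(c) "If `Π ∈ Π_s(G)`, then `m(π) = 1` for all `π ∈ Π`" [p0195 L8] is the QUASI-SPLIT analogue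
      (`d = 1`) and does not apply to `G_U` by name.  Typed in this package by the cf-rogawski lineage in
      `HodgeCM/Literature/RogawskiMultiplicityOne.lean` (`PacketClasses.discrete_mult_le_one`: 1 reading + 5 verbatim items,
      exact-strength record `U3Spectrum.exists_multiplicityInputs_iff`); citation wording per GAPS cfR4-N1.  LOAD-BEARING exactly
      in the Goursat step below
      (each summand of the block must be ONE irreducible; two orthogonal copies never pair —
      `RepDecomp.not_multiplicityOne_of_orthogonal_members`).
 (PRINT) von Neumann density `Literature.VonNeumann.DoubleCommutantDensity` (Pedersen 4.6.7–4.6.8) for (I6), as in gen 4.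

## Kernel (this file, fully proved)

`translate_of_compTower`: `deepen` → Goursat across members of finitely many distinct classes (prl1-g3
`RepDecomp.exists_inner_orbit_sum_ne_zero_of_members`; members = isotypic components by `MultOne`) → `coeff` → one nonzero
period term → `tr_comp` + `pullC_comp`.  `expand_of_compTower`: `vec_proj` → the block projection lies in `R(G)″`
(`PairingKernel.starProjection_blocks_mem_bicommutant`, arbitrary index type) → density on the finite-dimensional
`vec(F²H²(P_Γ))` → `coeff` per group element → re-indexing over `Σ_g Fin n_g`.

## Headline

`COR_CM_of_liu_comp (M) (hvN) (hL : LiuSupplyFace) (hI : MatsushimaCompFreeFace Hk) (hPo) (hQ) : HC_CM`.  Print-interface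
clauses on posited primitives: 0.  PRINT by name: the `MatsushimaDatum` facts (MM-2/4/8/10), `MultiplicityOne`,
`DoubleCommutantDensity`.  Seams: (D) `𝔐.seam/seam_F2/seam_pair`, `T.vec/vec_inj/κ/pair_vec/coeff/tr_comp/vec_proj`; (U)
`𝔐.seam_level`, `T.ι/cls/cls_inj`; (P∘U) `T.deepen`.  NOT IN PRINT: (P♮₂) `FreeObstruction` (PerL v5 §3.3) — THE
OBSTRUCTION, unchanged since gen 2.
-/
import Summits.HodgeConjecture.HodgeCM.StubTree.ExpandFromTower
import Summits.HodgeConjecture.HodgeCM.Automorphic.MultiplicityOne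

/-! PORT of `HodgeCM/StubTree/ComponentTower.lean` (HodgeCMPerL run 82) — verbatim mechanical port; provenance in the PORT header line. -/

noncomputable section

open scoped BigOperators InnerProductSpace

namespace HodgeCM

namespace Universe

open Literature.AlgebraicGeometry.Motives
open HodgeCM.PerL34.Spectral (IsUnitaryRep)
open HodgeCM.RepDecomp (IsoClass Members isotypic MultiplicityOne)

namespace IsoDatum

variable {U : Universe} {L : CMField} {ι₁ : L →+* ℂ} {V : HermSpace3 L ι₁} (D : U.IsoDatum V) (Hk : U.HeckeData)

/-- **A component-aware adelic tower dictionary for the isotypic datum `D`** (REDUCTION-v5 §R.11).  One unitary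
representation `R` of a group `G` on a Hilbert space `𝓗` (intended: right translation of `G_U(𝔸_{L⁺,f})` on the
`(2,0)`-type forms of all levels, a closed subspace of `L²(G_U(L⁺)\G_U(𝔸_{L⁺}))`), the class-to-form maps `vec Γ`
(extension by zero off the identity component of level `K_Γ`), and the seams of the module docstring.  Every field is
labelled (D) model seam / (U) reading step / (P∘U) print composed with a reading step; none is a quoted theorem, and each
holds in the intended model by the derivation given in the module docstring (M1 (a), (b) taken into account). -/
structure CompTower : Type 1 where
  /-- the group (intended `G_U(𝔸_{L⁺,f})`) -/
  G : Type
  [grp : Group G]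
  /-- the Hilbert space of `(2,0)`-type forms of all levels -/
  H : Type
  [nacg : NormedAddCommGroup H]
  [ips : InnerProductSpace ℂ H]
  [cs : CompleteSpace H]
  /-- the representation (right translation) -/
  R : G →* (H →L[ℂ] H)
  /-- it is unitary -/
  unitary : IsUnitaryRep R
  /-- **(D)** the class-to-form map at level `Γ` (extension by zero off the identity component; meaningful on `F²`) -/
  vec : (Γ : Level V) → (U.CohC (U.pms L ι₁ V Γ) 2 →ₗ[ℂ] H)
  /-- **(D)** … injective on `F²` -/
  vec_inj : ∀ (Γ : Level V) (c : U.CohC (U.pms L ι₁ V Γ) 2), c ∈ U.F2 Γ → vec Γ c = 0 → c = 0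
  /-- **(D, seam ii′)** the level-dependent constant of `∫_{P_Γ} c ∪ \bar d` against the Petersson product … -/
  κ : Level V → ℂ
  /-- … nonzero at every level -/
  κ_ne : ∀ Γ : Level V, κ Γ ≠ 0
  /-- **(D, seam ii′)** `∫_{P_Γ} c ∪ \bar d = κ_Γ · ⟪vec d, vec c⟫` on `F²(P_Γ)` -/
  pair_vec : ∀ (Γ : Level V) (c d : U.CohC (U.pms L ι₁ V Γ) 2), c ∈ U.F2 Γ → d ∈ U.F2 Γ →
    U.pair2 (U.pms L ι₁ V Γ) c d = κ Γ * ⟪vec Γ d, vec Γ c⟫_ℂ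
  /-- **(D) MATRIX COEFFICIENTS ARE PERIOD SUMS** (replaces gen 4's `realise ∧ support`; module docstring, M1 (a)): for
  every `g` and levels `Γ₁, Γ₂`, `⟪R g (vec y), vec x⟫` is a fixed finite combination of pull–pull pairings of `x` and `y`
  along tower coverings from common finer levels (the `K₁ ∩ gK₂g⁻¹`-components of the identity component; inclusions
  on the `x`-side, RATIONAL translated coverings on the `y`-side; GH (15.2), (15.4)). -/
  coeff : ∀ (g : G) (Γ₁ Γ₂ : Level V), ∃ (n : ℕ) (Γs : Fin n → Level V)
      (F : (j : Fin n) → U.Mor (U.pms L ι₁ V (Γs j)) (U.pms L ι₁ V Γ₁))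
      (F' : (j : Fin n) → U.Mor (U.pms L ι₁ V (Γs j)) (U.pms L ι₁ V Γ₂)) (a : Fin n → ℂ),
      (∀ j, F j ∈ Hk.tr Γ₁ (Γs j)) ∧ (∀ j, F' j ∈ Hk.tr Γ₂ (Γs j)) ∧
      ∀ x ∈ U.F2 Γ₁, ∀ y ∈ U.F2 Γ₂, ⟪R g (vec Γ₂ y), vec Γ₁ x⟫_ℂ =
        ∑ j, a j * U.pair2 (U.pms L ι₁ V (Γs j)) (U.pullC (F j) 2 x) (U.pullC (F' j) 2 y)
  /-- **(D)** tower coverings compose: `P_{Γ″} → P_{Γ′} → P_Γ` is a tower covering (`Universe.comp`, diagrammatic). -/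
  tr_comp : ∀ (Γ Γ' Γ'' : Level V), ∀ F ∈ Hk.tr Γ Γ', ∀ F' ∈ Hk.tr Γ' Γ'', U.comp F' F ∈ Hk.tr Γ Γ''
  /-- **(U)** the index of the block of a constituent `π` (intended: the twist orbit `X_f·π`; NO finiteness) … -/
  ι : D.A → Type
  /-- … its unitary-equivalence classes … -/
  cls : (π : D.A) → ι π → IsoClass R
  /-- … pairwise DISTINCT -/
  cls_inj : ∀ π, Function.Injective (cls π)
  /-- **(D, seam iii)** under `vec`, the projector `proj_π` is the orthogonal projection onto the closed block
  `closure (⨆_i isotypic (cls π i))`. -/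
  vec_proj : ∀ (π : D.A) (Γ : Level V) (c : U.CohC (U.pms L ι₁ V Γ) 2), c ∈ U.F2 Γ →
    vec Γ (D.proj Γ π c) = (⨆ i, isotypic R (cls π i)).topologicalClosure.starProjection (vec Γ c)
  /-- **(P∘U, S0‴) DEEP SUPPORT** (replaces gen 4's (S0′) `decompose ∧ mem_closure`; module docstring, M1 (b)): two
  nonzero block-`[π]` classes have pull-backs along tower coverings whose forms are supported on ONE common FINITE set of
  classes of the block, the second with all components nonzero. -/
  deepen : ∀ (π : D.A) (Γ Γ' : Level V) (c : U.CohC (U.pms L ι₁ V Γ) 2) (d : U.CohC (U.pms L ι₁ V Γ') 2),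
    c ∈ U.F2 Γ → d ∈ U.F2 Γ' → D.proj Γ π c = c → D.proj Γ' π d = d → c ≠ 0 → d ≠ 0 →
    ∃ (Γ₁ Γ₂ : Level V), ∃ F ∈ Hk.tr Γ Γ₁, ∃ F' ∈ Hk.tr Γ' Γ₂, ∃ (s : Finset (ι π)) (e : ι π → H),
      (∀ i ∈ s, e i ∈ isotypic R (cls π i)) ∧ (∀ i ∈ s, e i ≠ 0) ∧
      vec Γ₂ (U.pullC F' 2 d) = ∑ i ∈ s, e i ∧
      vec Γ₁ (U.pullC F 2 c) ∈ (⨆ i ∈ s, isotypic R (cls π i)).topologicalClosure ∧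
      vec Γ₁ (U.pullC F 2 c) ≠ 0

attribute [instance] CompTower.grp CompTower.nacg CompTower.ips CompTower.cs

namespace CompTower

variable {D Hk}

/-- **(P, BY NAME) MULTIPLICITY ONE for the `(2,0)`-type discrete spectrum of `G_U`** ([Rog90] §14.6 for the inner form
`G′ = G_U`, `2 ≤ d`: p. 242 exhaustion, Prop 14.6.2 + proof p. 243 (stable packets, READING), Thm 14.6.4, Thm 14.6.5 — typed in
`HodgeCM/Literature/RogawskiMultiplicityOne.lean`, `PacketClasses.discrete_mult_le_one`; Thm 13.3.3(c) is the quasi-split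
analogue; wording per GAPS cfR4-N1): every class of every block has exactly one member
(`RepDecomp.MultiplicityOne`), i.e. its isotypic component is irreducible (`RepDecomp.multiplicityOne_iff_isIrreducible`). -/
def MultOne (T : D.CompTower Hk) : Prop := ∀ (π : D.A) (i : T.ι π), MultiplicityOne T.R (T.cls π i)

end CompTower

variable {D Hk}

/-- **(I5) DERIVED** from a component-aware tower dictionary and multiplicity one (by name).  Kernel: `deepen`; prl1-g3's
Goursat pairing across the members of finitely many distinct classes (the members being the isotypic components, by
multiplicity one); `coeff`; one nonzero term; composition of tower coverings. -/
theorem translate_of_compTower (hH : U.Fact_pull_hodge) (hpc : U.Fact_pull_comp) (T : D.CompTower Hk)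
    (hM : T.MultOne) : D.Translate Hk := by
  classical
  intro π Γ Γ' c d hc hd hpc' hpd hc0 hd0
  obtain ⟨Γ₁, Γ₂, F, hF, F', hF', s, e, he, he0, hsum, hmem, hne⟩ := T.deepen π Γ Γ' c d hc hd hpc' hpd hc0 hd0
  -- under multiplicity one the isotypic components of the classes in `s` are THE members
  let W : (i : ↥s) → Members T.R (T.cls π i.1) := fun i => (RepDecomp.members_nonempty (T.cls π i.1)).some
  have hW : ∀ i : ↥s, isotypic T.R (T.cls π i.1) = ((W i).1.1 : Submodule ℂ T.H) := fun i =>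
    RepDecomp.isotypic_eq_of_multiplicityOne (hM π i.1) (W i)
  have hcls : Function.Injective (fun i : ↥s => T.cls π i.1) := (T.cls_inj π).comp Subtype.val_injective
  have hc' : ∀ i : ↥s, e i.1 ∈ ((W i).1.1 : Submodule ℂ T.H) := fun i => by
    rw [← hW i]; exact he i.1 i.2
  have hc'0 : ∀ i : ↥s, e i.1 ≠ 0 := fun i => he0 i.1 i.2
  have hu : T.vec Γ₁ (U.pullC F 2 c) ∈ (⨆ i : ↥s, ((W i).1.1 : Submodule ℂ T.H)).topologicalClosure := by
    refine Submodule.topologicalClosure_mono ?_ hmem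
    refine iSup₂_le fun i hi => ?_
    rw [hW ⟨i, hi⟩]
    exact le_iSup (fun i : ↥s => ((W i).1.1 : Submodule ℂ T.H)) ⟨i, hi⟩
  obtain ⟨g, hg⟩ := RepDecomp.exists_inner_orbit_sum_ne_zero_of_members T.unitary hcls W hc' hc'0 hu hne
  rw [Finset.sum_coe_sort s e, ← hsum] at hg
  -- expand the matrix coefficient into period pairings along tower coverings
  obtain ⟨n, Γs, Fj, Gj, a, hFj, hGj, hexp⟩ := T.coeff g Γ₁ Γ₂
  rw [hexp _ (pullC_mem_F2 hH F hc) _ (pullC_mem_F2 hH F' hd)] at hg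
  obtain ⟨j, -, hj⟩ := Finset.exists_ne_zero_of_sum_ne_zero hg
  have hj' : U.pair2 (U.pms L ι₁ V (Γs j)) (U.pullC (Fj j) 2 (U.pullC F 2 c)) (U.pullC (Gj j) 2 (U.pullC F' 2 d)) ≠ 0 :=
    fun h0 => hj (by rw [h0, mul_zero])
  refine ⟨Γs j, U.comp (Fj j) F, T.tr_comp Γ Γ₁ (Γs j) F hF (Fj j) (hFj j), U.comp (Gj j) F',
    T.tr_comp Γ' Γ₂ (Γs j) F' hF' (Gj j) (hGj j), ?_⟩
  rwa [pullC_comp_apply hpc, pullC_comp_apply hpc]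

/-- **(I6) DERIVED** from a component-aware tower dictionary, granted von Neumann density (PRINT), `Fact_pull_hodge` and
(I0) `ProjMem`.  Kernel: the block projection lies in `R(G)″`; density on the finite-dimensional `vec(F²H²(P_Γ))`;
`coeff` per group element; re-indexing. -/
theorem expand_of_compTower (hvN : Literature.VonNeumann.DoubleCommutantDensity) (h0 : D.ProjMem)
    (T : D.CompTower Hk) : D.Expand := by
  classical
  intro π Γ
  -- the block projection and its density
  set E := (⨆ i, isotypic T.R (T.cls π i)).topologicalClosure.starProjection with hE
  have hEbi := PairingKernel.starProjection_blocks_mem_bicommutant T.unitary (T.cls π)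
  have hd := PairingKernel.approx_of_mem_bicommutant hvN T.unitary hEbi
  -- the finite-dimensional space of forms of level Γ
  let S : Submodule ℂ T.H := (U.F2 Γ).map (T.vec Γ)
  haveI : FiniteDimensional ℂ S := inferInstance
  obtain ⟨b, hb, hbS⟩ := PairingKernel.exists_mem_inner_eq_of_approx S _ E hd
  obtain ⟨s, cf, rfl⟩ := PairingKernel.exists_finset_eq_sum_of_mem_span_range (T.R : T.G → (T.H →L[ℂ] T.H)) hb
  -- per group element: the period expansion of `⟪vec y, R g (vec x)⟫ = ⟪R g⁻¹ (vec y), vec x⟫`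
  choose n Γs Ff Gf a hFf hGf hexp using fun g : T.G => T.coeff g⁻¹ Γ Γ
  have hg : ∀ g : T.G, ∀ x ∈ U.F2 Γ, ∀ y ∈ U.F2 Γ, ⟪T.vec Γ y, T.R g (T.vec Γ x)⟫_ℂ =
      ∑ j, a g j * U.pair2 (U.pms L ι₁ V (Γs g j)) (U.pullC (Ff g j) 2 x) (U.pullC (Gf g j) 2 y) := by
    intro g x hx y hy
    have h2 : ⟪T.vec Γ y, T.R g (T.vec Γ x)⟫_ℂ = ⟪T.R g⁻¹ (T.vec Γ y), T.vec Γ x⟫_ℂ := by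
      rw [T.unitary.inner_apply_left, inv_inv]
    rw [h2]
    exact hexp g x hx y hy
  -- flatten the index `Σ g ∈ s, Fin (n g)` to `Fin N`
  let J := Σ g : ↥s, Fin (n g.1)
  let eJ : J ≃ Fin (Fintype.card J) := Fintype.equivFin J
  refine ⟨Fintype.card J, fun k => Γs (eJ.symm k).1.1 (eJ.symm k).2, fun k => Ff (eJ.symm k).1.1 (eJ.symm k).2,
    fun k => Gf (eJ.symm k).1.1 (eJ.symm k).2, fun k => T.κ Γ * (cf (eJ.symm k).1.1 * a (eJ.symm k).1.1 (eJ.symm k).2),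
    fun x y hx hy => ?_⟩
  have hpx : D.proj Γ π x ∈ U.F2 Γ := h0 Γ π x hx
  have hxS : T.vec Γ x ∈ S := Submodule.mem_map_of_mem hx
  have hyS : T.vec Γ y ∈ S := Submodule.mem_map_of_mem hy
  have hEb : ⟪T.vec Γ y, E (T.vec Γ x)⟫_ℂ = ⟪T.vec Γ y, (∑ g ∈ s, cf g • T.R g) (T.vec Γ x)⟫_ℂ := by
    rw [← inner_conj_symm, hbS _ hxS _ hyS, inner_conj_symm]
  rw [T.pair_vec Γ _ _ hpx hy, T.vec_proj π Γ x hx, ← hE, hEb, sum_apply, inner_sum, Finset.mul_sum]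
  simp only [smul_apply, inner_smul_right]
  -- reindex the right-hand side
  let f : J → ℂ := fun σ => T.κ Γ * (cf σ.1.1 * a σ.1.1 σ.2) *
    U.pair2 (U.pms L ι₁ V (Γs σ.1.1 σ.2)) (U.pullC (Ff σ.1.1 σ.2) 2 x) (U.pullC (Gf σ.1.1 σ.2) 2 y)
  have hre : (∑ k : Fin (Fintype.card J), f (eJ.symm k)) = ∑ g : ↥s, ∑ j : Fin (n g.1), f ⟨g, j⟩ :=
    (Equiv.sum_comp eJ.symm f).trans (Fintype.sum_sigma f)
  change _ = ∑ k : Fin (Fintype.card J), f (eJ.symm k)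
  rw [hre, ← Finset.sum_coe_sort s (fun g => T.κ Γ * (cf g * ⟪T.vec Γ y, T.R g (T.vec Γ x)⟫_ℂ))]
  refine Finset.sum_congr rfl fun g _ => ?_
  have hgg := hg (g : T.G) x hx y hy
  rw [hgg, Finset.mul_sum, Finset.mul_sum]
  refine Finset.sum_congr rfl fun j _ => ?_
  simp only [f]
  ring

end IsoDatum

/-! ### Packaging: the Matsushima model with a component-aware tower dictionary in place of (I5) ∧ (I6) -/

variable (U : Universe) (Hk : U.HeckeData)

/-- **Matsushima + component-tower package (face binders)**: at every admissible face a Matsushima model `𝔐` whose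
isotypic datum carries a component-aware tower dictionary with multiplicity one (by name) — replacing (I5) AND (I6) —
and THE OBSTRUCTION (P♮₂) `FreeObstruction` (PerL v5 §3.3, NOT in print). -/
def MatsushimaCompFreeFace : Prop :=
  ∀ (F : CMField), IsGalois ℚ F → 6 ≤ Module.finrank ℚ F →
    ∀ (f : Face F) (ι₁ : F →+* ℂ), f.Admissible ι₁ → ∀ V : HermSpace3 F ι₁,
      ∃ (Pi : Type) (_ : DecidableEq Pi) (𝔐 : U.MatsushimaDatum V Hk Pi),
        (∃ T : 𝔐.isoDatum.CompTower Hk, T.MultOne) ∧ 𝔐.isoDatum.FreeObstruction F f.psi ι₁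

/-- The same under the PerL binders. -/
def MatsushimaCompFreePerL : Prop :=
  ∀ (K L : CMField) (j : K →+* L), IsNormalClosure ℚ K L →
    Module.finrank ℚ K = 6 → (Module.finrank ℚ L = 24 ∨ Module.finrank ℚ L = 48) →
    ∀ (φ : Fin 3 → (K →+* ℂ)), IsFrame φ →
    ∀ (ι₁ : L →+* ℂ), ι₁.comp j = φ 0 →
    ∀ (t : Fin 4 → CMType K), IsPerLTypes φ t →
    ∀ V : HermSpace3 L ι₁,
      ∃ (Pi : Type) (_ : DecidableEq Pi) (𝔐 : U.MatsushimaDatum V Hk Pi),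
        (∃ T : 𝔐.isoDatum.CompTower Hk, T.MultOne) ∧ 𝔐.isoDatum.FreeObstruction K t (φ 0)

variable {U Hk}

/-- Component-tower package ⇒ Matsushima package (face binders), given von Neumann density and the model facts
`Fact_pull_hodge`, `Fact_pull_comp`. -/
theorem matsushimaFreeFace_of_comp (hH : U.Fact_pull_hodge) (hpc : U.Fact_pull_comp)
    (hvN : Literature.VonNeumann.DoubleCommutantDensity) (h : U.MatsushimaCompFreeFace Hk) :
    U.MatsushimaFreeFace Hk := by
  intro F hG h6 f ι₁ hadm V
  obtain ⟨Pi, hdec, 𝔐, ⟨T, hM⟩, hO⟩ := h F hG h6 f ι₁ hadm V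
  exact ⟨Pi, hdec, 𝔐, IsoDatum.translate_of_compTower hH hpc T hM,
    IsoDatum.expand_of_compTower hvN 𝔐.projMem T, hO⟩

/-- Component-tower package ⇒ Matsushima package (PerL binders). -/
theorem matsushimaFreePerL_of_comp (hH : U.Fact_pull_hodge) (hpc : U.Fact_pull_comp)
    (hvN : Literature.VonNeumann.DoubleCommutantDensity) (h : U.MatsushimaCompFreePerL Hk) :
    U.MatsushimaFreePerL Hk := by
  intro K L j hN hK hL φ hφ ι₁ hι t ht V
  obtain ⟨Pi, hdec, 𝔐, ⟨T, hM⟩, hO⟩ := h K L j hN hK hL φ hφ ι₁ hι t ht V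
  exact ⟨Pi, hdec, 𝔐, IsoDatum.translate_of_compTower hH hpc T hM,
    IsoDatum.expand_of_compTower hvN 𝔐.projMem T, hO⟩

/-- **rfwf Thm 4.1 (`PeriodThmF`)** from the model facts, von Neumann density, the Liu supply package and the
Matsushima + component-tower package. -/
theorem periodThmF_of_liu_comp (M : U.ModelAxioms) (hvN : Literature.VonNeumann.DoubleCommutantDensity)
    (hL : U.LiuSupplyFace) (hI : U.MatsushimaCompFreeFace Hk) : U.PeriodThmF :=
  periodThmF_of_liu_matsushima M hL (matsushimaFreeFace_of_comp M.pull_hodge M.pull_comp hvN hI)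

/-- **PerL v5 Thm 4.4** from the same. -/
theorem perL44_of_liu_comp (M : U.ModelAxioms) (hvN : Literature.VonNeumann.DoubleCommutantDensity)
    (hL : U.LiuSupplyPerL) (hI : U.MatsushimaCompFreePerL Hk) : U.PerL44 :=
  perL44_of_liu_matsushima M hL (matsushimaFreePerL_of_comp M.pull_hodge M.pull_comp hvN hI)

variable (U)

/-- **COR-CM (gen 5, R.11)**: `HC_CM` from the 28 model facts, von Neumann's double commutant theorem (PRINT), (S)
`LiuSupplyFace` (PRINT ∧ Dict), and at every face a typed identity-component Matsushima dictionary carrying a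
COMPONENT-AWARE adelic tower dictionary with multiplicity one by name (both former PRINT-INTERFACE clauses (I5), (I6)
DERIVED; the gen-4 tower seams found wanting in M1 replaced by `coeff` and `deepen`) and THE OBSTRUCTION (P♮₂)
`FreeObstruction` (PerL v5 §3.3, not in print); plus `PohlmannSpan` and `Qw8Sufficiency`. -/
theorem COR_CM_of_liu_comp (M : U.ModelAxioms) (hvN : Literature.VonNeumann.DoubleCommutantDensity)
    (hL : U.LiuSupplyFace) {Hk : U.HeckeData} (hI : U.MatsushimaCompFreeFace Hk) (hPo : U.PohlmannSpan)
    (hQ : U.Qw8Sufficiency) : U.HC_CM :=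
  COR_CM_of_liu_matsushima U M hL (matsushimaFreeFace_of_comp M.pull_hodge M.pull_comp hvN hI) hPo hQ

/-- **PerL (`W_per^L`)** from the same inputs under the PerL binders. -/
theorem perL_of_liu_comp (M : U.ModelAxioms) (hvN : Literature.VonNeumann.DoubleCommutantDensity)
    (hL : U.LiuSupplyPerL) {Hk : U.HeckeData} (hI : U.MatsushimaCompFreePerL Hk) : U.PerL :=
  perL_of_liu_matsushima U M hL (matsushimaFreePerL_of_comp M.pull_hodge M.pull_comp hvN hI)

end Universe

end HodgeCM

end
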